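import Mathlib

/-!
# T5AvatarDictionary — the one-dimensional avatar dictionary (algebraic core)

Kernel form of route/T5-SUPPORT-p2.md §3 (pub-hodge-repro2, Tier 5; support for §G.3 S2 of
route/T5-route-3.md, residual [R-4′]): from a "locally algebraic" p-adic character `Ψ` of the
idèle class group one DEFINES the algebraic Hecke character
`λ(a) := ι⁻¹(Ψ(a) · a_p^{−γ}) · a_∞^{γ}`
(Hsieh, Doc. Math. 19 (2014), Introduction: the display `φ(a) := ι^{-1}(φ̂(rec_K(a)) a_p^{-m} ā_p^{m}) a_∞^{m} ā_∞^{-m}`),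
and checks: `λ` is a homomorphism, trivial on the principal idèles, equal to `a ↦ a_∞^{γ}` where
`Ψ` and `a ↦ a_p^{γ}` are trivial (the infinity type), `Ψ` is recovered from `λ` by the avatar
relation, `λ` is unique, and `λ` is continuous when `Ψ · a_p^{−γ}` is trivial on an open subgroup.

Abstract setting (everything is a commutative group; no field structure is needed for the
algebra): `A` = the idèles `𝔸_𝒦^×`, `H ≤ A` = the principal idèles `𝒦^×`, `Cp` = `ℂ_p^×`,
`C` = `ℂ^×`, `ι : C ≃* Cp` = the fixed isomorphism `ι : ℂ ≅ ℂ_p` on units, `Ψ : A →* Cp`,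
`ep : A →* Cp` = `a ↦ a_p^{γ}`, `einf : A →* C` = `a ↦ a_∞^{γ}`, with the two compatibilities
`Ψ α = 1` and `ι (einf α) = ep α` for principal `α` (the latter is (★) of the memo:
`ι⁻¹(α_p^{γ}) = α_∞^{γ}` because both are the images of the algebraic number `α^{γ}`).

The topological clauses: a homomorphism trivial on an open subgroup is locally constant; a
continuous homomorphism from a (pre)connected group into a totally disconnected group is
trivial (used for `Ψ` on `𝒦_∞^×`).

Prose source: route/T5-SUPPORT-p2.md v1 §3 (Lemma, proof steps (i)–(v)). Imports: Mathlib only.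
-/

namespace Summit.Ventures.HodgeRepro2.T5AvatarDictionary

/-- The data of the one-dimensional avatar dictionary, in abstract form: the idèle group `A`,
the subgroup `H` of principal idèles, the `p`-adic character `Ψ`, the exponent characters
`ep = (a ↦ a_p^{γ})` and `einf = (a ↦ a_∞^{γ})`, the fixed isomorphism `ι`, and the two
compatibilities on principal idèles. -/
structure AvatarData (A Cp C : Type*) [CommGroup A] [CommGroup Cp] [CommGroup C] where
  /-- the principal idèles `𝒦^× ⊂ 𝔸_𝒦^×` -/
  H : Subgroup A
  /-- the `p`-adic character `Ψ = Ψ_Gal ∘ rec_𝒦` -/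
  Ψ : A →* Cp
  /-- `a ↦ a_p^{γ}` -/
  ep : A →* Cp
  /-- `a ↦ a_∞^{γ}` -/
  einf : A →* C
  /-- the fixed isomorphism `ι : ℂ ≅ ℂ_p` restricted to units -/
  ι : C ≃* Cp
  /-- `Ψ` is trivial on the principal idèles (it is a character of the idèle class group) -/
  Ψ_triv : ∀ α ∈ H, Ψ α = 1
  /-- (★): `ι(α_∞^{γ}) = α_p^{γ}` for principal `α` -/
  compat : ∀ α ∈ H, ι (einf α) = ep α

variable {A Cp C : Type*} [CommGroup A] [CommGroup Cp] [CommGroup C]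

namespace AvatarData

variable (D : AvatarData A Cp C)

/-- The finite-idèle part `μ(a) := Ψ(a) · a_p^{−γ}` of the dictionary. -/
def mu : A →* Cp := D.Ψ * D.ep⁻¹

/-- `μ(a) = Ψ(a) · (a_p^{γ})⁻¹`. -/
theorem mu_apply (a : A) : D.mu a = D.Ψ a * (D.ep a)⁻¹ := rfl

/-- The Hecke character `λ(a) := ι⁻¹(Ψ(a) · a_p^{−γ}) · a_∞^{γ}` (Hsieh's display, weight `γ`). -/
def lam : A →* C := D.ι.symm.toMonoidHom.comp D.mu * D.einf

/-- `λ(a) = ι⁻¹(Ψ(a) · (a_p^{γ})⁻¹) · a_∞^{γ}`. -/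
theorem lam_apply (a : A) : D.lam a = D.ι.symm (D.Ψ a * (D.ep a)⁻¹) * D.einf a := rfl

/-- Step (ii): `λ` is trivial on the principal idèles, i.e. `λ` is a character of the idèle
class group (a Hecke character). -/
theorem lam_triv (α : A) (hα : α ∈ D.H) : D.lam α = 1 := by
  rw [lam_apply, D.Ψ_triv α hα, one_mul, ← D.compat α hα, map_inv, MulEquiv.symm_apply_apply,
    inv_mul_cancel]

/-- Step (iii)+(v): where `Ψ` and `a ↦ a_p^{γ}` are trivial (e.g. on `𝒦_∞^×`), `λ` is the
exponent character `a ↦ a_∞^{γ}` — the infinity type of `λ` is `γ`. -/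
theorem lam_eq_einf_of (a : A) (h₁ : D.Ψ a = 1) (h₂ : D.ep a = 1) : D.lam a = D.einf a := by
  rw [lam_apply, h₁, h₂, inv_one, one_mul, map_one, one_mul]

/-- The avatar relation: `Ψ(a) = ι(λ(a) · (a_∞^{γ})⁻¹) · a_p^{γ}` — `Ψ` is the avatar of `λ`. -/
theorem avatar_relation (a : A) : D.Ψ a = D.ι (D.lam a * (D.einf a)⁻¹) * D.ep a := by
  rw [lam_apply, mul_inv_cancel_right, MulEquiv.apply_symm_apply, inv_mul_cancel_right]

/-- Uniqueness: a homomorphism `ν` satisfying the avatar relation equals `λ`. -/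
theorem lam_unique (ν : A →* C) (hν : ∀ a, D.Ψ a = D.ι (ν a * (D.einf a)⁻¹) * D.ep a) :
    ν = D.lam := by
  ext a
  have h := hν a
  rw [lam_apply]
  have h' : D.ι (ν a * (D.einf a)⁻¹) = D.Ψ a * (D.ep a)⁻¹ := by
    rw [h, mul_inv_cancel_right]
  rw [← h', MulEquiv.symm_apply_apply, inv_mul_cancel_right]

/-- Multiplicativity of the dictionary in `Ψ` (same exponents, same `ι`): if `Ψ₁`, `Ψ₂` are
avatars of `λ₁`, `λ₂` with exponents `ep₁, einf₁` and `ep₂, einf₂`, then `Ψ₁ * Ψ₂` is the avatar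
of `λ₁ * λ₂` with exponents `ep₁ * ep₂`, `einf₁ * einf₂` (the step `χ_i := λ_i⁻¹ ψ⁻¹` of §2). -/
theorem avatar_relation_mul (D₁ D₂ : AvatarData A Cp C) (hι : D₁.ι = D₂.ι) (a : A) :
    (D₁.Ψ * D₂.Ψ) a =
      D₁.ι ((D₁.lam * D₂.lam) a * ((D₁.einf * D₂.einf) a)⁻¹) * (D₁.ep * D₂.ep) a := by
  simp only [MonoidHom.mul_apply]
  rw [D₁.avatar_relation a, D₂.avatar_relation a, hι]
  have h : D₂.ι (D₁.lam a * D₂.lam a * (D₁.einf a * D₂.einf a)⁻¹)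
      = D₂.ι (D₁.lam a * (D₁.einf a)⁻¹) * D₂.ι (D₂.lam a * (D₂.einf a)⁻¹) := by
    rw [← map_mul]
    congr 1
    rw [mul_inv]
    ac_rfl
  rw [h]
  ac_rfl

end AvatarData

section Topology

/-- A homomorphism into any type that is trivial on an open subgroup `U` is locally constant
(it is constant on every coset `x * U`). Step (iv) of the memo. -/
theorem isLocallyConstant_of_trivial_on_open {G N : Type*} [Group G] [TopologicalSpace G]
    [ContinuousMul G] [MulOneClass N] (f : G →* N) (U : Subgroup G) (hU : IsOpen (U : Set G))
    (hf : ∀ u ∈ U, f u = 1) : IsLocallyConstant f := by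
  rw [IsLocallyConstant.iff_exists_open]
  intro x
  refine ⟨(fun y => x⁻¹ * y) ⁻¹' (U : Set G), hU.preimage (continuous_const.mul continuous_id),
    ?_, ?_⟩
  · simp
  · intro y hy
    have hy' : x⁻¹ * y ∈ U := hy
    calc f y = f (x * (x⁻¹ * y)) := by rw [mul_inv_cancel_left]
      _ = f x * f (x⁻¹ * y) := map_mul _ _ _
      _ = f x := by rw [hf _ hy', mul_one]

/-- Step (iv): if `μ = Ψ · a_p^{−γ}` is trivial on an open subgroup and `a ↦ a_∞^{γ}` is
continuous, then the Hecke character `λ` is continuous. (`ι⁻¹` need not be continuous: it is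
applied to a locally constant function.) -/
theorem AvatarData.continuous_lam [TopologicalSpace A] [ContinuousMul A] [TopologicalSpace C]
    [ContinuousMul C] (D : AvatarData A Cp C) (U : Subgroup A) (hU : IsOpen (U : Set A))
    (hμ : ∀ u ∈ U, D.mu u = 1) (hinf : Continuous D.einf) : Continuous D.lam := by
  have h1 : IsLocallyConstant D.mu := isLocallyConstant_of_trivial_on_open D.mu U hU hμ
  have h2 : Continuous (fun a => D.ι.symm (D.mu a)) := (h1.comp D.ι.symm).continuous
  exact h2.mul hinf

/-- Step (iii): a continuous homomorphism from a preconnected group (e.g. `𝒦_∞^× ≅ (ℂ^×)^Σ`)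
into a totally disconnected group (e.g. `ℂ_p^×`) is trivial. -/
theorem eq_one_of_preconnectedSpace {G N : Type*} [Group G] [TopologicalSpace G]
    [PreconnectedSpace G] [MulOneClass N] [TopologicalSpace N] [TotallyDisconnectedSpace N]
    (f : G →* N) (hf : Continuous f) (g : G) : f g = 1 := by
  have hpre : IsPreconnected (Set.range f) := by
    rw [← Set.image_univ]
    exact isPreconnected_univ.image f hf.continuousOn
  have hsub := hpre.subsingleton
  have h := hsub (Set.mem_range_self g) (Set.mem_range_self 1)
  rw [map_one] at h
  exact h

end Topology

end Summit.Ventures.HodgeRepro2.T5AvatarDictionary
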